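/-
Copyright (c) 2026 the pub-hodgecm-mathlib formalisation cell (harness21).  Prover seat hodgecm-mathlib-K2Liu-p09 (g5): Track B «K2-LIT»,
hLiu418 = stmt-HodgeConjecture-24832; LEAD F0P6-plan (g12) RULING M-156m 2026-09-04T07:51:54Z «A7 = GK COCYCLE ROAD», file B3∕B6.
-/
import Summits.HodgeConjecture.HodgeConjecture.Theorems.K2LiuRankOneLevelHolomorphy   -- ★ B5b `integrable_and_integral_eq`, `aestronglyMeasurable_of_forall_add_mem`
import Summits.HodgeConjecture.HodgeConjecture.Theorems.K2LiuQRationalLFactor       -- ★ (a) `qVar_natMul_add`, `one_sub_mul_qVar_ne_zero`, `norm_unramValue_le_one`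
import HarnessLib

/-!
# Crux `HLiu418`, road `K2_Liu`, organ A7-reg (RULING M-156m, GK cocycle road), file B3∕B6:
# ABSTRACT RANK-ONE INTERTWINING OPERATORS — value at level `K′`, equivariance, and preservation of regularity at `s = ½`

Cell `hodgecm-mathlib`, crux item hLiu418 = `stmt-HodgeConjecture-24832`; squad K2 ∕ K2Liu; prover K2Liu-p09 (g5).
THEOREMS ONLY (no `def`, no instance, no notation, no named-fact hypothesis, no `sorry`); lane `--supports stmt-HodgeConjecture-24832`
(count-neutral helper).  DEF-FREE and GROUP-ABSTRACT: `G` is any topological group; the concrete doubled `U(2,2)` enters only in B1∕B2∕B4.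

THE SETTING.  A «rank-one datum» on a topological group `G` at a completion `𝕜 = K_w` (additive Haar measure `μ`): maps `u ū : 𝕜 → G`
(the root group and its opposite), `w : G` (the rank-one Weyl representative), a unitary character `ν : 𝕜ˣ → ℂˣ`, an exponent `e ∈ ℂ`
and a constant `C₀ ∈ ℂ`, tied to a function `f : G → ℂ` by the ONE relation
  `(SL₂)  ∀ x ≠ 0, ∀ g, f (w · u(x) · g) = C₀ · ν(x)⁻¹ · ‖x‖^{−e} · f (ū(x⁻¹) · g)`
(in `U(2,2)`: `w u(x) = u(x⁻¹) α^∨(x) ū(x⁻¹)`-type identity, left `N`-invariance of `f` and the value `θ(α^∨(x)) = C₀ ν(x)⁻¹ ‖x‖^{−e}` of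
the inducing character — discharged per root in B1∕B2), and a right-invariance of `f` under an open subgroup `K′` with
`y⁻¹ u(𝔭^m) y, y⁻¹ ū(𝔭^m) y ⊆ K′` at the evaluation point `y` (such an `m` EXISTS for every `y`, §1 — no Iwasawa decomposition is used).
The rank-one operator is written out as the integral `∫ f(w · u(x) · y) dμ(x)`; nothing is defined.

CONTENTS.
* §1 `exists_level`: for continuous `u ū` with `u 0 = ū 0 = 1`, an open `K′` and any `y`, some `𝔭^m` works.
* §2 `integrable_and_integral_eq` (VALUE): `∫ f(w u(x) y) dx = Σ_{a∈R} μ(𝔭^m) f(w u(a) y) + C₀ f(y) (1 − q⁻¹) μ(𝒪) (unramValue ν · q^{1−e})^{m+1} L(e−1, ν)`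
  (`re e > 1`; ★ B5b), `R` = representatives of `𝔭^{−m} ⧸ 𝔭^m` (★ `exists_finset_primePowBall_eq_biUnion`).
* §3 EQUIVARIANCE (identities of Bochner integrals, no integrability needed): under `w u(x) t = t′ w u(c x)` the operator picks up
  `f(t′ ·)`'s eigenvalue times `‖c‖⁻¹` (`integral_mul_torus`); under `w u(x) n = n′ w u(x + c₀)` with `f` left-`n′`-invariant it is
  unchanged (`integral_mul_unipotent`) — the two clauses of «`θ`-section ⇒ `s_αθ`-section».
* §4 FAMILIES (B6): with `e(s) = a·s + c` and the NORMALISED value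
  `N(s) := (1 − unramValue ν · q^{−(e(s)−1)}) · Σ_{a∈R} μ(𝔭^m) f_s(w u(a) y) + C₀(s) f_s(y) (1 − q⁻¹) μ(𝒪) (unramValue ν · q^{1−e(s)})^{m+1}`
  one has `∫ f_s(w u(x) y) dx = L(e(s)−1, ν) · N(s)` on `re e(s) > 1` (`integral_eq_lFactor_mul_normalised`) and `N` is `q^{-s}`-rational
  and REGULAR at `½` as soon as the finitely many `s ↦ f_s(w u(a) y)`, `s ↦ f_s(y)` and `C₀` are (`isQRationalRegularAt_normalised`) —
  never dividing by `L`, so the pole of the third Gindikin–Karpelevich factor `L_F(2s−1, χ_F)` at `½` is harmless.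
HONEST LABEL.  `HC_CM` is proved only modulo the 7 printed citations (2 remaining named inputs: hLiu418 = `stmt-HodgeConjecture-24832`,
h413 = `stmt-HodgeConjecture-24833`) until rung 0 closes.

## References
* [Casselman1980] W. Casselman, *The unramified principal series of p-adic groups I*, Compositio Math. 40 (1980), §3 (rank-one operators `T_α`,
  `c_α(χ)`, the cocycle `T_w = Π T_α`).
* [KudlaSweet1997] S. Kudla, W. J. Sweet, Israel J. Math. 98 (1997), §1 (rationality in `q^{-s}` of the intertwining operator on standard sections).
* [Tate1950] J. Tate, *Fourier analysis in number fields and Hecke's zeta-functions* (1950), §2.4–2.5.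
* [BushnellHenniart2006] C. J. Bushnell, G. Henniart, *The local Langlands conjecture for GL(2)* (2006), §1.1, §23 (smooth vectors, level).
-/

set_option autoImplicit false
set_option linter.dupNamespace false -- the mandated namespace repeats `HodgeConjecture.HodgeConjecture`

noncomputable section

open MeasureTheory Filter Topology Set Polynomial
open scoped NNReal ENNReal
open NumberField IsDedekindDomain
open Literature.NumberTheory.GaloisRepresentations.IsNonarchimedeanLocalField
open Literature.NumberTheory.Automorphic Literature.NumberTheory.Automorphic.LocalFieldHaar
open Summit.HodgeConjecture.HodgeConjecture.Cruxes.HLiu418.K2LiuQRationalDefs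
open Summit.HodgeConjecture.HodgeConjecture.Cruxes.HLiu418.K2LiuLocalLFactorDefs
open Summit.HodgeConjecture.HodgeConjecture.Cruxes.HLiu418.K2LiuQRationalLFactor
open Summit.HodgeConjecture.HodgeConjecture.Cruxes.HLiu418.K2LiuRankOneLevelHolomorphy

namespace Summit.HodgeConjecture.HodgeConjecture.Cruxes.HLiu418.K2LiuRankOneOperators

variable {K : Type} [Field K] [NumberField K] {w : HeightOneSpectrum (𝓞 K)} {G : Type*} [Group G]

/-! ## §1 The level at an evaluation point -/

/-- **A level exists at every point.**  For continuous `u : K_w → G` with `u 0 = 1`, an open subgroup `K′` and any `y ∈ G`, the map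
`t ↦ y⁻¹ u(t) y` takes some ball `𝔭^m` into `K′`. [cite: BushnellHenniart2006, §1.1] -/
theorem exists_level [TopologicalSpace G] [IsTopologicalGroup G] (u : w.adicCompletion K → G) (hu : Continuous u) (hu0 : u 0 = 1) (K' : Subgroup G) (hK' : IsOpen (K' : Set G))
    (y : G) : ∃ m : ℕ, ∀ t ∈ primePowBall (w.adicCompletion K) (m : ℤ), y⁻¹ * u t * y ∈ K' := by
  have hc : Continuous fun t : w.adicCompletion K => y⁻¹ * u t * y := (continuous_const.mul hu).mul continuous_const
  have hmem : (fun t : w.adicCompletion K => y⁻¹ * u t * y) ⁻¹' (K' : Set G) ∈ 𝓝 (0 : w.adicCompletion K) := by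
    refine hc.continuousAt.preimage_mem_nhds (hK'.mem_nhds ?_)
    rw [hu0, mul_one, inv_mul_cancel]
    exact K'.one_mem
  obtain ⟨m, hm⟩ := exists_primePowBall_subset_of_mem_nhds_zero hmem
  exact ⟨m, fun t ht => hm ht⟩

/-- a common level for two maps `u`, `ū` (take the larger ball index). [cite: BushnellHenniart2006, §1.1] -/
theorem exists_level₂ [TopologicalSpace G] [IsTopologicalGroup G] (u ū : w.adicCompletion K → G) (hu : Continuous u) (hu0 : u 0 = 1) (hū : Continuous ū) (hū0 : ū 0 = 1)
    (K' : Subgroup G) (hK' : IsOpen (K' : Set G)) (y : G) :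
    ∃ m : ℕ, (∀ t ∈ primePowBall (w.adicCompletion K) (m : ℤ), y⁻¹ * u t * y ∈ K') ∧
      ∀ t ∈ primePowBall (w.adicCompletion K) (m : ℤ), y⁻¹ * ū t * y ∈ K' := by
  obtain ⟨m₁, h₁⟩ := exists_level u hu hu0 K' hK' y
  obtain ⟨m₂, h₂⟩ := exists_level ū hū hū0 K' hK' y
  refine ⟨max m₁ m₂, fun t ht => h₁ t (primePowBall_antitone (by exact_mod_cast le_max_left m₁ m₂) ht),
    fun t ht => h₂ t (primePowBall_antitone (by exact_mod_cast le_max_right m₁ m₂) ht)⟩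

/-! ## §2 The value of the rank-one operator at level `m` -/

section Value

variable [MeasurableSpace (w.adicCompletion K)] [BorelSpace (w.adicCompletion K)]
  (μ : Measure (w.adicCompletion K)) [μ.IsAddHaarMeasure]

omit [MeasurableSpace (w.adicCompletion K)] [BorelSpace (w.adicCompletion K)] [μ.IsAddHaarMeasure] in
/-- translating the root variable inside `f (w · u(·) · y)` by `t ∈ 𝔭^m` does nothing when `y⁻¹ u(t) y ∈ K′` and `f` is right-`K′`-invariant.
[cite: Casselman1980, §3] -/
theorem apply_mul_u_add {f : G → ℂ} {K' : Subgroup G} (hfK : ∀ g, ∀ k ∈ K', f (g * k) = f g)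
    {u : w.adicCompletion K → G} (hu_add : ∀ x t, u (x + t) = u x * u t) (w₀ y : G) {m : ℤ}
    (hmu : ∀ t ∈ primePowBall (w.adicCompletion K) m, y⁻¹ * u t * y ∈ K') (x : w.adicCompletion K)
    {t : w.adicCompletion K} (ht : t ∈ primePowBall (w.adicCompletion K) m) : f (w₀ * u (x + t) * y) = f (w₀ * u x * y) := by
  have h : w₀ * u (x + t) * y = w₀ * u x * y * (y⁻¹ * u t * y) := by rw [hu_add]; group
  rw [h, hfK _ _ (hmu t ht)]

/-- **THE VALUE OF THE RANK-ONE OPERATOR AT LEVEL `m`** (abstract Gindikin–Karpelevich step): for `f` right-`K′`-invariant satisfying the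
`SL₂` relation `f(w u(x) g) = C₀ ν(x)⁻¹ ‖x‖^{−e} f(ū(x⁻¹) g)` (`ν` unitary, `re e > 1`), and a level `m` at `y`,
`x ↦ f(w u(x) y)` is integrable and
`∫ f(w u(x) y) dx = Σ_{a∈R} μ(𝔭^m) f(w u(a) y) + C₀ f(y) (1 − q⁻¹) μ(𝒪) · (unramValue ν · q^{1−e})^{m+1} · L(e − 1, ν)`
(`R` representatives of `𝔭^{−m}` modulo `𝔭^m`; for ramified `ν` the last term is `0`). [cite: Casselman1980, §3 Thm. 3.1] [cite: Tate1950, §2.4–2.5] -/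
theorem integrable_and_integral_eq {f : G → ℂ} {K' : Subgroup G} (hfK : ∀ g, ∀ k ∈ K', f (g * k) = f g)
    {u ū : w.adicCompletion K → G} (hu_add : ∀ x t, u (x + t) = u x * u t) (w₀ : G)
    (ν : (w.adicCompletion K)ˣ →* ℂˣ) (hν : ∀ x, ‖((ν x : ℂˣ) : ℂ)‖ = 1) (e C₀ : ℂ) (he : 1 < e.re)
    (hrel : ∀ (x : (w.adicCompletion K)ˣ) (g : G),
      f (w₀ * u x * g) = C₀ * (((ν x)⁻¹ : ℂˣ) : ℂ) * ((normAbs (w.adicCompletion K) (x : w.adicCompletion K) : ℝ) : ℂ) ^ (-e) *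
        f (ū ((x⁻¹ : (w.adicCompletion K)ˣ) : w.adicCompletion K) * g))
    (y : G) (m : ℕ) (hmu : ∀ t ∈ primePowBall (w.adicCompletion K) (m : ℤ), y⁻¹ * u t * y ∈ K')
    (hmū : ∀ t ∈ primePowBall (w.adicCompletion K) (m : ℤ), y⁻¹ * ū t * y ∈ K')
    (R : Finset (w.adicCompletion K))
    (hRinc : ∀ a ∈ R, ∀ a' ∈ R, a ≠ a' → a - a' ∉ primePowBall (w.adicCompletion K) (m : ℤ))
    (hRcov : primePowBall (w.adicCompletion K) (-(m : ℤ)) = ⋃ a ∈ R, {x | x - a ∈ primePowBall (w.adicCompletion K) (m : ℤ)}) :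
    Integrable (fun x => f (w₀ * u x * y)) μ ∧
      ∫ x, f (w₀ * u x * y) ∂μ = (∑ a ∈ R, (μ.real (primePowBall (w.adicCompletion K) (m : ℤ)) : ℂ) * f (w₀ * u a * y)) +
        C₀ * f y * (1 - (residueFieldCard (w.adicCompletion K) : ℂ)⁻¹) * μ.real (primePowBall (w.adicCompletion K) 0) *
          ((unramValue K w ν * (residueFieldCard (w.adicCompletion K) : ℂ) ^ (1 - e)) ^ (m + 1) * lFactor K w ν (e - 1)) := by
  set g : w.adicCompletion K → ℂ := fun x => f (w₀ * u x * y) with hg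
  -- local constancy modulo `𝔭^m` (everywhere), hence measurability and the head hypothesis
  have hconst : ∀ x : w.adicCompletion K, ∀ t ∈ primePowBall (w.adicCompletion K) (m : ℤ), g (x + t) = g x :=
    fun x t ht => apply_mul_u_add hfK hu_add w₀ y hmu x ht
  have hgm : AEStronglyMeasurable g μ := aestronglyMeasurable_of_forall_add_mem g m hconst
  have hhead : ∀ a ∈ R, ∀ x, x - a ∈ primePowBall (w.adicCompletion K) (m : ℤ) → g x = g a := by
    intro a _ x hx
    have h := hconst a (x - a) hx
    rwa [add_sub_cancel] at h
  -- the tail hypothesis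
  have htail : ∀ x : (w.adicCompletion K)ˣ, (x : w.adicCompletion K) ∉ primePowBall (w.adicCompletion K) (-(m : ℤ)) →
      g x = C₀ * f y * (((ν x)⁻¹ : ℂˣ) : ℂ) * ((normAbs (w.adicCompletion K) (x : w.adicCompletion K) : ℝ) : ℂ) ^ (-e) := by
    intro x hx
    -- `x⁻¹ ∈ 𝔭^m`, so `ū(x⁻¹)` is absorbed by `K′`
    have hxinv : ((x⁻¹ : (w.adicCompletion K)ˣ) : w.adicCompletion K) ∈ primePowBall (w.adicCompletion K) (m : ℤ) := by
      rw [mem_primePowBall_iff] at hx ⊢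
      rw [not_le] at hx
      rw [Units.val_inv_eq_inv_val, map_inv₀]
      have hx0 : (0 : ℝ≥0) < normAbs (w.adicCompletion K) (x : w.adicCompletion K) := (zpow_pos inv_residueFieldCard_pos _).trans hx
      rw [inv_le_comm₀ hx0 (zpow_pos inv_residueFieldCard_pos _), ← zpow_neg]
      exact hx.le
    have hk := hmū _ hxinv
    have h1 : ū ((x⁻¹ : (w.adicCompletion K)ˣ) : w.adicCompletion K) * y = y * (y⁻¹ * ū ((x⁻¹ : (w.adicCompletion K)ˣ) : w.adicCompletion K) * y) := by
      group
    show f (w₀ * u x * y) = _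
    rw [hrel x y, h1, hfK _ _ hk]
    ring
  obtain ⟨hint, hval⟩ := K2LiuRankOneLevelHolomorphy.integrable_and_integral_eq μ m R hRinc hRcov g hgm hhead ν hν (C₀ * f y) e he htail
  exact ⟨hint, hval⟩

end Value

/-! ## §3 Equivariance of the rank-one operator (identities of Bochner integrals) -/

section Equivariance

variable [MeasurableSpace (w.adicCompletion K)] [BorelSpace (w.adicCompletion K)]
  (μ : Measure (w.adicCompletion K)) [μ.IsAddHaarMeasure]

/-- **Torus clause.**  If `w u(x) t = t′ w u(c x)` (`c ≠ 0`) for all `x` and `f(t′ g) = Θ f(g)` for all `g`, then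
`∫ f(w u(x) (t y)) dx = Θ ‖c‖⁻¹ ∫ f(w u(x) y) dx` — the `T`-equivariance of the rank-one operator with the character `s_αθ`.
[cite: Casselman1980, §3] -/
theorem integral_mul_torus (f : G → ℂ) {u : w.adicCompletion K → G} (w₀ t t' : G) {c : w.adicCompletion K} (hc : c ≠ 0)
    (hconj : ∀ x, w₀ * u x * t = t' * (w₀ * u (c * x))) {Θ : ℂ} (hft' : ∀ g, f (t' * g) = Θ * f g) (y : G) :
    ∫ x, f (w₀ * u x * (t * y)) ∂μ =
      Θ * ((normAbs (w.adicCompletion K) c⁻¹ : ℝ≥0) : ℝ) * ∫ x, f (w₀ * u x * y) ∂μ := by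
  have h1 : ∀ x, f (w₀ * u x * (t * y)) = Θ * f (w₀ * u (c * x) * y) := fun x => by
    rw [← mul_assoc, hconj, mul_assoc, hft', mul_assoc]
  simp_rw [h1]
  rw [integral_const_mul, integral_comp_mul_left μ hc (fun x => f (w₀ * u x * y)), Complex.real_smul, mul_assoc]

/-- **Unipotent clause.**  If `w u(x) n = n′ w u(x + c₀)` for all `x` and `f` is left-`n′`-invariant, then
`∫ f(w u(x) (n y)) dx = ∫ f(w u(x) y) dx` — the `N`-invariance of the rank-one operator. [cite: Casselman1980, §3] -/
theorem integral_mul_unipotent (f : G → ℂ) {u : w.adicCompletion K → G} (w₀ n n' : G) {c₀ : w.adicCompletion K}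
    (hconj : ∀ x, w₀ * u x * n = n' * (w₀ * u (x + c₀))) (hfn' : ∀ g, f (n' * g) = f g) (y : G) :
    ∫ x, f (w₀ * u x * (n * y)) ∂μ = ∫ x, f (w₀ * u x * y) ∂μ := by
  have h1 : ∀ x, f (w₀ * u x * (n * y)) = f (w₀ * u (x + c₀) * y) := fun x => by
    rw [← mul_assoc, hconj, mul_assoc, hfn']
  simp_rw [h1]
  exact integral_add_right_eq_self (fun x => f (w₀ * u x * y)) c₀

omit [BorelSpace (w.adicCompletion K)] [μ.IsAddHaarMeasure] in
/-- **Right translation clause.**  The rank-one operator commutes with right translations: trivially `(A f)(y k) = A(f(· k))(y)`; in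
particular right-`K′`-invariance of `f` passes to `y ↦ ∫ f(w u(x) y) dx`. [cite: Casselman1980, §3] -/
theorem integral_mul_right_of_invariant (f : G → ℂ) {u : w.adicCompletion K → G} (w₀ y k : G) {K' : Subgroup G} (hk : k ∈ K')
    (hfK : ∀ g, ∀ k ∈ K', f (g * k) = f g) : ∫ x, f (w₀ * u x * (y * k)) ∂μ = ∫ x, f (w₀ * u x * y) ∂μ := by
  refine integral_congr_ae (Filter.Eventually.of_forall fun x => ?_)
  show f (w₀ * u x * (y * k)) = f (w₀ * u x * y)
  rw [← mul_assoc, hfK _ _ hk]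

end Equivariance

/-! ## §4 Families: the normalised operator preserves regularity at `½` -/

section Families

variable [MeasurableSpace (w.adicCompletion K)] [BorelSpace (w.adicCompletion K)]
  (μ : Measure (w.adicCompletion K)) [μ.IsAddHaarMeasure]

/-- **`A f = L(e − 1, ν) · N f` with the NORMALISED value `N f`** (re-arrangement of §2 on `re e > 1`, where `1 − unramValue ν · q^{−(e−1)} ≠ 0`):
`N := (1 − unramValue ν q^{−(e−1)}) · HEAD + C₀ f(y) (1 − q⁻¹) μ(𝒪) (unramValue ν q^{1−e})^{m+1}`. [cite: Casselman1980, §3 Thm. 3.1] [cite: KudlaSweet1997, §1] -/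
theorem integral_eq_lFactor_mul_normalised {f : G → ℂ} {K' : Subgroup G} (hfK : ∀ g, ∀ k ∈ K', f (g * k) = f g)
    {u ū : w.adicCompletion K → G} (hu_add : ∀ x t, u (x + t) = u x * u t) (w₀ : G)
    (ν : (w.adicCompletion K)ˣ →* ℂˣ) (hν : ∀ x, ‖((ν x : ℂˣ) : ℂ)‖ = 1) (e C₀ : ℂ) (he : 1 < e.re)
    (hrel : ∀ (x : (w.adicCompletion K)ˣ) (g : G),
      f (w₀ * u x * g) = C₀ * (((ν x)⁻¹ : ℂˣ) : ℂ) * ((normAbs (w.adicCompletion K) (x : w.adicCompletion K) : ℝ) : ℂ) ^ (-e) *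
        f (ū ((x⁻¹ : (w.adicCompletion K)ˣ) : w.adicCompletion K) * g))
    (y : G) (m : ℕ) (hmu : ∀ t ∈ primePowBall (w.adicCompletion K) (m : ℤ), y⁻¹ * u t * y ∈ K')
    (hmū : ∀ t ∈ primePowBall (w.adicCompletion K) (m : ℤ), y⁻¹ * ū t * y ∈ K')
    (R : Finset (w.adicCompletion K))
    (hRinc : ∀ a ∈ R, ∀ a' ∈ R, a ≠ a' → a - a' ∉ primePowBall (w.adicCompletion K) (m : ℤ))
    (hRcov : primePowBall (w.adicCompletion K) (-(m : ℤ)) = ⋃ a ∈ R, {x | x - a ∈ primePowBall (w.adicCompletion K) (m : ℤ)}) :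
    ∫ x, f (w₀ * u x * y) ∂μ = lFactor K w ν (e - 1) *
      ((1 - unramValue K w ν * (residueFieldCard (w.adicCompletion K) : ℂ) ^ (-(e - 1))) *
          (∑ a ∈ R, (μ.real (primePowBall (w.adicCompletion K) (m : ℤ)) : ℂ) * f (w₀ * u a * y)) +
        C₀ * f y * (1 - (residueFieldCard (w.adicCompletion K) : ℂ)⁻¹) * μ.real (primePowBall (w.adicCompletion K) 0) *
          (unramValue K w ν * (residueFieldCard (w.adicCompletion K) : ℂ) ^ (1 - e)) ^ (m + 1)) := by
  rw [(integrable_and_integral_eq μ hfK hu_add w₀ ν hν e C₀ he hrel y m hmu hmū R hRinc hRcov).2]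
  have hne : 1 - unramValue K w ν * (residueFieldCard (w.adicCompletion K) : ℂ) ^ (-(e - 1)) ≠ 0 := by
    have h := one_sub_mul_qVar_ne_zero (one_lt_residueFieldCard (w.adicCompletion K)) (norm_unramValue_le_one hν)
      (z := e - 1) (by rw [Complex.sub_re, Complex.one_re]; linarith)
    rwa [qVar_def] at h
  rw [lFactor_def]
  field_simp

omit [BorelSpace (w.adicCompletion K)] [μ.IsAddHaarMeasure] in
/-- **The normalised value is `q^{-s}`-rational and regular at `½` whenever its ingredients are.**  With `e(s) = a·s + c` (`a ∈ ℕ`,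
`c ∈ ℂ`), a unitary `ν`, and `s ↦ C₀(s)`, `s ↦ f_s(y)`, `s ↦ f_s(w u(b) y)` (`b ∈ R`) regular at `½`, the function
`s ↦ (1 − unramValue ν q^{−(e(s)−1)}) Σ_{b∈R} μ(𝔭^m) f_s(w u(b) y) + C₀(s) f_s(y) (1 − q⁻¹) μ(𝒪) (unramValue ν q^{1−e(s)})^{m+1}` is regular at `½`.
[cite: KudlaSweet1997, §1] [cite: Casselman1980, §3] -/
theorem isQRationalRegularAt_normalised (f : ℂ → G → ℂ) {u : w.adicCompletion K → G} (w₀ y : G)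
    (ν : (w.adicCompletion K)ˣ →* ℂˣ) (a : ℕ) (c : ℂ) (C₀ : ℂ → ℂ) (m : ℕ) (R : Finset (w.adicCompletion K))
    (hC₀ : IsQRationalRegularAt (residueFieldCard (w.adicCompletion K)) (1 / 2) C₀)
    (hfy : IsQRationalRegularAt (residueFieldCard (w.adicCompletion K)) (1 / 2) fun s => f s y)
    (hfR : ∀ b ∈ R, IsQRationalRegularAt (residueFieldCard (w.adicCompletion K)) (1 / 2) fun s => f s (w₀ * u b * y)) :
    IsQRationalRegularAt (residueFieldCard (w.adicCompletion K)) (1 / 2) fun s =>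
      (1 - unramValue K w ν * (residueFieldCard (w.adicCompletion K) : ℂ) ^ (-(((a : ℂ) * s + c) - 1))) *
          (∑ b ∈ R, (μ.real (primePowBall (w.adicCompletion K) (m : ℤ)) : ℂ) * f s (w₀ * u b * y)) +
        C₀ s * f s y * (1 - (residueFieldCard (w.adicCompletion K) : ℂ)⁻¹) * μ.real (primePowBall (w.adicCompletion K) 0) *
          (unramValue K w ν * (residueFieldCard (w.adicCompletion K) : ℂ) ^ (1 - ((a : ℂ) * s + c))) ^ (m + 1) := by
  set q : ℕ := residueFieldCard (w.adicCompletion K) with hq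
  have hq0 : q ≠ 0 := residueFieldCard_ne_zero _
  -- the two monomials `q^{-(e(s) - 1)} = q^{1-c} (q^{-s})^a` and `q^{1 - e(s)}` (the same thing) are regular
  have hmono : IsQRationalRegularAt q (1 / 2) fun s => (q : ℂ) ^ (1 - ((a : ℂ) * s + c)) := by
    have h := ((isQRationalRegularAt_qVar_pow q (1 / 2) a).const_mul (qVar q (c - 1))).congr (ψ := fun s => (q : ℂ) ^ (1 - ((a : ℂ) * s + c)))
      fun s => by
        show qVar q (c - 1) * qVar q s ^ a = (q : ℂ) ^ (1 - ((a : ℂ) * s + c))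
        rw [← qVar_natMul_add hq0, qVar_def]; congr 1; ring
    exact h
  have hmono' : IsQRationalRegularAt q (1 / 2) fun s => (q : ℂ) ^ (-(((a : ℂ) * s + c) - 1)) :=
    hmono.congr fun s => by show (q : ℂ) ^ (1 - ((a : ℂ) * s + c)) = _; congr 1; ring
  have hhead : IsQRationalRegularAt q (1 / 2) fun s => ∑ b ∈ R, (μ.real (primePowBall (w.adicCompletion K) (m : ℤ)) : ℂ) * f s (w₀ * u b * y) :=
    IsQRationalRegularAt.sum R fun b hb => (hfR b hb).const_mul _
  have h1 : IsQRationalRegularAt q (1 / 2) fun s => 1 - unramValue K w ν * (q : ℂ) ^ (-(((a : ℂ) * s + c) - 1)) :=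
    (isQRationalRegularAt_const q _ 1).sub (hmono'.const_mul _)
  have h2 : IsQRationalRegularAt q (1 / 2) fun s => (unramValue K w ν * (q : ℂ) ^ (1 - ((a : ℂ) * s + c))) ^ (m + 1) := by
    have h := hmono.const_mul (unramValue K w ν)
    exact IsQRationalRegularAt.prod (Finset.range (m + 1)) (Φ := fun _ s => unramValue K w ν * (q : ℂ) ^ (1 - ((a : ℂ) * s + c)))
      (fun _ _ => h) |>.congr fun s => by simp [Finset.prod_const, Finset.card_range]
  exact (h1.mul hhead).add ((((hC₀.mul hfy).mul (isQRationalRegularAt_const q _ _)).mul (isQRationalRegularAt_const q _ _)).mul h2)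

end Families

end Summit.HodgeConjecture.HodgeConjecture.Cruxes.HLiu418.K2LiuRankOneOperators

end
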